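import Summits.KontsevichZagierPeriods.KontsevichZagierPeriods.Theorems.LinRedNormalFormArrangementNormalFormStubRebaseSimplePosOneFibreCornerSteep

/-!
# Stub `stub_rebaseSimplePosOneZero` (crux `ArrangementNormalForm`, line `janus-bands`) —
part `CornerBands`: closing the blown-up bands

Corner toolkit for the double-corner bands at `B = 1`, fourth file. The two charts of the corner
blow-up (`RebasePos.cornerBlowUp`, `RebasePos.cornerBlowUpSteep`) output literal one-fibre
bands above the letter `0` whose bounds are `ρ`-FREE (they depend on the angular base
coordinate only). Such bands are closed by the landed one-fibre case tree WITHOUT residue: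
* `RebasePos.good_above_of_nonpar` — the assembly `RebasePos.good_above_of_residual₂` for
  NON-PARALLEL transverse bounds (no hypothesis on parallel bands), any base dimension;
* `RebasePos.good_xfree_band` — a band `0 < U < V` above the letter `0` whose bounds have no
  silent part (`U.1 ∘ castSucc = 0 = V.1 ∘ castSucc`) is congruent to the subgroup generated by
  `GG B 2 1`: a `y`-free bound is the product case, parallel bounds have constant width (thick
  band, `rebaseSimplePos_thickBand`), and otherwise every apex level `κ` with
  `U − κ = A (V − U)` is a CONSTANT, so the residual sub-cells of `good_above_of_nonpar` have no
  corner (`good_thick_of_noCorner₂`, `good_far_of_noCorner₂`).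
Registered as `rebaseSimplePos_xfreeBand`.

References: M. Kontsevich, D. Zagier, *Periods* (2001), §1.2, rules (1a), (2).
-/

noncomputable section

open Set MeasureTheory MvPolynomial
open Literature.NumberTheory.Transcendental Literature.ModelTheory.ExponentialFields

namespace Summit.KontsevichZagierPeriods.ArrangementNormalForm.JanusBands

namespace RebasePos

open SeparatePos

section Nonpar

variable {B m m' : ℕ} (L : Fin m → (Fin B → ℚ) × ℚ) (e : Fin m → ℕ) (ℓ₁ ℓ₂ : (Fin B → ℚ) × ℚ) (n₁ n₂ : ℕ)

/-- **A band above its letter with NON-PARALLEL transverse bounds, residual hypotheses with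
provenance.** As `good_above_of_residual₂`, with the hypothesis `u_y ≠ v_y` in place of the
callback for parallel bands: `Hthick` and `Hfar` are only required for bands with the same
bounds `u < v` whose domain is contained in the given one. -/
theorem good_above_of_nonpar (s : KZ.IntegralRep (B + 1 + 1)) (M : Fin m' → (Fin (B + 1) → ℚ) × ℚ)
    (p : MvPolynomial (Fin B) ℚ) (u v : (Fin (B + 1) → ℚ) × ℚ) (h12 : n₁ = 0 ∨ n₂ = 0)
    (hbd : Bornology.IsBounded s.domain)
    (hdom : s.domain = gDom B 1 m' M (fun _ => Sum.inr u) (fun _ => Sum.inr v))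
    (hint : EqOn s.integrand (glit B 1 p L e ℓ₁ ℓ₂ n₁ n₂ (fun _ => some 0)) s.domain)
    (hu : u.1 (Fin.last B) ≠ 0) (hv : v.1 (Fin.last B) ≠ 0) (hpar : u.1 (Fin.last B) ≠ v.1 (Fin.last B))
    (hcell : ∀ z : Fin (B + 1 + 1) → ℝ, (∀ j, 0 < affF B 1 (M j) z) →
      0 < affF B 1 u z ∧ affF B 1 u z < affF B 1 v z)
    (Hthick : ∀ (m'' : ℕ) (s' : KZ.IntegralRep (B + 1 + 1)) (M' : Fin m'' → (Fin (B + 1) → ℚ) × ℚ)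
      (κ : (Fin (B + 1) → ℚ) × ℚ) (A : ℚ), s'.domain ⊆ s.domain → Bornology.IsBounded s'.domain →
      s'.domain = gDom B 1 m'' M' (fun _ => Sum.inr u) (fun _ => Sum.inr v) →
      EqOn s'.integrand (glit B 1 p L e ℓ₁ ℓ₂ n₁ n₂ (fun _ => some 0)) s'.domain →
      κ.1 (Fin.last B) = 0 → u - κ = A • (v - u) → 0 < A →
      (∀ z : Fin (B + 1 + 1) → ℝ, (∀ j, 0 < affF B 1 (M' j) z) →
        affF B 1 κ z < 0 ∧ 0 < affF B 1 u z ∧ affF B 1 u z < affF B 1 v z) →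
      ∃ c ∈ AddSubgroup.closure (GGset B 2 1), KZ.of s' - c ∈ KZ.relations)
    (Hfar : ∀ (m'' : ℕ) (s' : KZ.IntegralRep (B + 1 + 1)) (M' : Fin m'' → (Fin (B + 1) → ℚ) × ℚ)
      (κ : (Fin (B + 1) → ℚ) × ℚ) (A : ℚ), s'.domain ⊆ s.domain → Bornology.IsBounded s'.domain →
      s'.domain = gDom B 1 m'' M' (fun _ => Sum.inr u) (fun _ => Sum.inr v) →
      EqOn s'.integrand (glit B 1 p L e ℓ₁ ℓ₂ n₁ n₂ (fun _ => some 0)) s'.domain →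
      κ.1 (Fin.last B) = 0 → u - κ = A • (v - u) → 0 < A →
      (∀ z : Fin (B + 1 + 1) → ℝ, (∀ j, 0 < affF B 1 (M' j) z) →
        0 < affF B 1 κ z ∧ affF B 1 u z < affF B 1 v z ∧ 2 * affF B 1 κ z ≤ affF B 1 v z) →
      ∃ c ∈ AddSubgroup.closure (GGset B 2 1), KZ.of s' - c ∈ KZ.relations) :
    ∃ c ∈ AddSubgroup.closure (GGset B 2 1), KZ.of s - c ∈ KZ.relations := by
  -- adapted from `RebasePos.good_above_of_residual₂` (part `ResidualSub`), parallel case removed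
  set A' : ℚ := u.1 (Fin.last B) with hA'
  set B' : ℚ := v.1 (Fin.last B) with hB'
  have hBA : B' - A' ≠ 0 := sub_ne_zero.2 (Ne.symm hpar)
  set A : ℚ := A' / (B' - A') with hAdef
  set κ : (Fin (B + 1) → ℚ) × ℚ := u - A • (v - u) with hκdef
  have hκ : κ.1 (Fin.last B) = 0 := by
    simp only [hκdef, Prod.fst_sub, Prod.smul_fst, Pi.sub_apply, Pi.smul_apply, smul_eq_mul, hAdef]
    rw [← hA', ← hB']
    field_simp
    ring
  have hA : u - κ = A • (v - u) := by rw [hκdef, sub_sub_cancel]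
  have hA1 : A ≠ -1 := fun h => by
    have : A' = -(B' - A') := by
      rw [hAdef] at h
      field_simp at h
      linarith
    exact hv (show B' = 0 by linarith)
  have hA0 : A ≠ 0 := fun h => by
    rw [hAdef, div_eq_zero_iff] at h
    exact h.elim hu hBA
  have huκ : ∀ z : Fin (B + 1 + 1) → ℝ, affF B 1 u z - affF B 1 κ z =
      (A : ℝ) * (affF B 1 v z - affF B 1 u z) := fun z => by
    have key := congrArg (fun q => affF B 1 q z) hA
    simp only [affF_sub'', affF_smul'] at key
    exact key
  rcases lt_trichotomy A (-1) with hlt | heq | hgt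
  · exact good_belowApex L e ℓ₁ ℓ₂ n₁ n₂ s M p u v κ A h12 hbd hdom hint hκ hA (by linarith) hcell
  · exact absurd heq hA1
  rcases lt_trichotomy A 0 with hlt0 | heq0 | hgt0
  · have hlt' : (A : ℝ) < 0 := by exact_mod_cast hlt0
    have hgt' : (-1 : ℝ) < A := by exact_mod_cast hgt
    refine good_levelSplit (fun _ => some 0) (fun _ => u) (fun _ => v) s M L e p ℓ₁ ℓ₂
      (fun _ => Sum.inr u) (fun _ => Sum.inr v) h12 hbd hdom hint (fun _ => rfl) (fun _ => rfl) 0 κ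
      (fun i c hi _ => absurd (Subsingleton.elim i 0) hi) (fun c hc => by cases hc; simpa using hκ)
      fun z hz => ?_
    have h1 := huκ z
    have h2 := (hcell z hz).2
    constructor <;> nlinarith
  · exact absurd heq0 hA0
  by_cases hκ0 : κ = 0
  · exact good_coaxial 0 s M L e p ℓ₁ ℓ₂ n₁ n₂ u v A h12 hbd hdom hint (by rw [sub_zero, ← hA, hκ0, sub_zero])
      fun z hz => (hcell z hz).2
  obtain ⟨s₁, s₂, hm₁, hm₂, hi₁, hi₂, hd₁, hd₂, hrel⟩ := cutBase s M _ _ hdom κ hκ0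
  have hsub₁ : s₁.domain ⊆ s.domain := fun z hz => ((hm₁ z).1 hz).1
  have hsub₂ : s₂.domain ⊆ s.domain := fun z hz => ((hm₂ z).1 hz).1
  refine good_of_split hrel ?_ ?_
  · have hne : v - (2 : ℚ) • κ ≠ 0 := ne_zero_of_last (by
      simp only [Prod.fst_sub, Prod.smul_fst, Pi.sub_apply, Pi.smul_apply, smul_eq_mul, hκ,
        mul_zero, sub_zero]
      exact hv)
    obtain ⟨s₃, s₄, hm₃, hm₄, hi₃, hi₄, hd₃, hd₄, hrel'⟩ := cutBase s₁ (Fin.snoc M κ) _ _ hd₁ _ hne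
    have hsub₃ : s₃.domain ⊆ s.domain := fun z hz => hsub₁ ((hm₃ z).1 hz).1
    have hsub₄ : s₄.domain ⊆ s.domain := fun z hz => hsub₁ ((hm₄ z).1 hz).1
    have h2κ : ∀ z : Fin (B + 1 + 1) → ℝ, affF B 1 (v - (2 : ℚ) • κ) z = affF B 1 v z - 2 * affF B 1 κ z :=
      fun z => by rw [affF_sub'', affF_smul']; push_cast; ring
    refine good_of_split hrel' ?_ ?_
    · refine Hfar _ s₃ _ κ A hsub₃ (hbd.subset hsub₃) hd₃ (by rw [hi₃, hi₁]; exact hint.mono hsub₃)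
        hκ hA hgt0 fun z hz => ?_
      obtain ⟨hz', hfar⟩ := rows_snoc hz
      obtain ⟨hz'', hκpos⟩ := rows_snoc hz'
      rw [h2κ] at hfar
      exact ⟨hκpos, (hcell z hz'').2, by linarith⟩
    · refine good_aboveApexNear L e ℓ₁ ℓ₂ n₁ n₂ s₄ _ p u v κ A 2 h12 (hbd.subset hsub₄) hd₄
        (by rw [hi₄, hi₁]; exact hint.mono hsub₄) hκ hA hgt0.le fun z hz => ?_
      obtain ⟨hz', hnear⟩ := rows_snoc hz
      obtain ⟨hz'', hκpos⟩ := rows_snoc hz'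
      rw [affF_neg', h2κ] at hnear
      exact ⟨hκpos, (hcell z hz'').2, by linarith⟩
  · refine Hthick _ s₂ _ κ A hsub₂ (hbd.subset hsub₂) hd₂ (by rw [hi₂]; exact hint.mono hsub₂)
      hκ hA hgt0 fun z hz => ?_
    obtain ⟨hz', hneg⟩ := rows_snoc hz
    rw [affF_neg'] at hneg
    exact ⟨by linarith, hcell z hz'⟩

end Nonpar

section XFree

variable {B m m' : ℕ}

/-- A form without linear part is its constant. -/
theorem affF_of_fst_eq_zero (κ : (Fin (B + 1) → ℚ) × ℚ) (h : κ.1 = 0) (z : Fin (B + 1 + 1) → ℝ) :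
    affF B 1 κ z = κ.2 := by
  simp [affF, h]

/-- The apex level of bounds without silent part has no linear part. -/
theorem apex_fst_eq_zero (U V κ : (Fin (B + 1) → ℚ) × ℚ) (A : ℚ)
    (hU : ∀ i : Fin B, U.1 (Fin.castSucc i) = 0) (hV : ∀ i : Fin B, V.1 (Fin.castSucc i) = 0)
    (hκ : κ.1 (Fin.last B) = 0) (hA : U - κ = A • (V - U)) : κ.1 = 0 := by
  funext i
  refine Fin.lastCases hκ (fun j => ?_) i
  have h := congrArg (fun q : (Fin (B + 1) → ℚ) × ℚ => q.1 (Fin.castSucc j)) hA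
  simp only [Prod.fst_sub, Pi.sub_apply, Prod.smul_fst, Pi.smul_apply, smul_eq_mul, hU j, hV j,
    sub_zero, mul_zero, zero_sub, neg_eq_zero] at h
  simpa using h

variable (L : Fin m → (Fin B → ℚ) × ℚ) (e : Fin m → ℕ) (ℓ₁ ℓ₂ : (Fin B → ℚ) × ℚ) (n₁ n₂ : ℕ)

/-- **A band above the letter `0` whose bounds have no silent part is good.** See the module
docstring: product case, constant width (thick band), or `good_above_of_nonpar` with constant
apex levels (no corner). -/
theorem good_xfree_band (s : KZ.IntegralRep (B + 1 + 1)) (M : Fin m' → (Fin (B + 1) → ℚ) × ℚ)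
    (p : MvPolynomial (Fin B) ℚ) (U V : (Fin (B + 1) → ℚ) × ℚ) (h12 : n₁ = 0 ∨ n₂ = 0)
    (hbd : Bornology.IsBounded s.domain)
    (hdom : s.domain = gDom B 1 m' M (fun _ => Sum.inr U) (fun _ => Sum.inr V))
    (hint : EqOn s.integrand (glit B 1 p L e ℓ₁ ℓ₂ n₁ n₂ (fun _ => some 0)) s.domain)
    (hU : ∀ i : Fin B, U.1 (Fin.castSucc i) = 0) (hV : ∀ i : Fin B, V.1 (Fin.castSucc i) = 0)
    (hcell : ∀ z : Fin (B + 1 + 1) → ℝ, (∀ j, 0 < affF B 1 (M j) z) →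
      0 < affF B 1 U z ∧ affF B 1 U z < affF B 1 V z) :
    ∃ c ∈ AddSubgroup.closure (GGset B 2 1), KZ.of s - c ∈ KZ.relations := by
  have h0 : ∀ c : (Fin (B + 1) → ℚ) × ℚ, some (0 : (Fin (B + 1) → ℚ) × ℚ) = some c →
      c.1 (Fin.last B) = 0 := fun c hc => by cases hc; rfl
  -- a `y`-free bound: product case
  by_cases hUy : U.1 (Fin.last B) = 0
  · exact good_product (fun _ => some 0) (fun _ => U) (fun _ => V) s M L e p ℓ₁ ℓ₂
      (fun _ => Sum.inr U) (fun _ => Sum.inr V) h12 hbd hdom hint (fun _ => rfl) (fun _ => rfl)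
      fun _ c hc => Or.inl (by rw [hUy, h0 c hc])
  by_cases hVy : V.1 (Fin.last B) = 0
  · exact good_product (fun _ => some 0) (fun _ => U) (fun _ => V) s M L e p ℓ₁ ℓ₂
      (fun _ => Sum.inr U) (fun _ => Sum.inr V) h12 hbd hdom hint (fun _ => rfl) (fun _ => rfl)
      fun _ c hc => Or.inr (by rw [hVy, h0 c hc])
  -- parallel bounds: constant width
  by_cases hpar : U.1 (Fin.last B) = V.1 (Fin.last B)
  · have hVU : (V - U).1 = 0 := by
      funext i
      refine Fin.lastCases ?_ (fun j => ?_) i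
      · simp [hpar]
      · simp [hU j, hV j]
    have hw : ∀ z : Fin (B + 1 + 1) → ℝ, affF B 1 V z - affF B 1 U z = ((V - U).2 : ℚ) := fun z => by
      rw [← affF_sub'', affF_of_fst_eq_zero _ hVU]
    by_cases hne : ∃ z : Fin (B + 1 + 1) → ℝ, ∀ j, 0 < affF B 1 (M j) z
    · obtain ⟨z₀, hz₀⟩ := hne
      have hc₀ : (0 : ℝ) < ((V - U).2 : ℚ) := by rw [← hw z₀]; linarith [(hcell z₀ hz₀).2]
      exact good_thickBand L e ℓ₁ ℓ₂ n₁ n₂ s M p U V _ h12 hbd hdom hint hc₀ fun z hz =>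
        ⟨(hcell z hz).1, by rw [← hw z]; linarith⟩
    · push Not at hne
      refine good_of_null s ?_
      have he : s.domain = ∅ := by
        rw [hdom]
        exact Set.eq_empty_iff_forall_notMem.2 fun z hz => by
          rw [mem_gDom_one] at hz
          obtain ⟨j, hj⟩ := hne z
          exact absurd (hz.1 j) (not_lt.2 hj)
      rw [he, measure_empty]
  -- non-parallel: every apex level is a constant, no corner
  refine good_above_of_nonpar L e ℓ₁ ℓ₂ n₁ n₂ s M p U V h12 hbd hdom hint hUy hVy hpar hcell
    (fun m'' s' M' κ A _ hbd' hdom' hint' hκ hA hA0 hcell' => ?_)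
    (fun m'' s' M' κ A _ hbd' hdom' hint' hκ hA hA0 hcell' => ?_)
  · have hκ1 := apex_fst_eq_zero U V κ A hU hV hκ hA
    refine good_thick_of_noCorner₂ L e ℓ₁ ℓ₂ n₁ n₂ s' M' p U V κ A h12 hbd' hdom' hint' hA hA0 hcell'
      fun z hz hκz _ _ => ?_
    obtain ⟨z₀, hz₀⟩ := closure_nonempty_iff.1 ⟨z, hz⟩
    have h := (hcell' z₀ hz₀).1
    rw [affF_of_fst_eq_zero κ hκ1] at h hκz
    linarith
  · have hκ1 := apex_fst_eq_zero U V κ A hU hV hκ hA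
    refine good_far_of_noCorner₂ L e ℓ₁ ℓ₂ n₁ n₂ s' M' p U V κ A h12 hbd' hdom' hint' hA hA0 hcell'
      fun z hz hκz _ _ => ?_
    obtain ⟨z₀, hz₀⟩ := closure_nonempty_iff.1 ⟨z, hz⟩
    have h := (hcell' z₀ hz₀).1
    rw [affF_of_fst_eq_zero κ hκ1] at h hκz
    linarith

end XFree

end RebasePos

/-- **Registered part of `stub_rebaseSimplePosOneZero` (line `janus-bands`): a band above the
letter `0` whose bounds have no silent part is good** (`RebasePos.good_xfree_band`): one
lettered fibre over a base of dimension `B + 1` (letter `0`, affine bounds `0 < U < V` on the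
base cell with `U`, `V` depending on `y` only, exponents `n₁ n₂` with `n₁ = 0 ∨ n₂ = 0`) is
congruent modulo `KZ.relations` to the subgroup generated by `GG B 2 1` (product case, thick
band of constant width, or `RebasePos.good_above_of_nonpar` whose residual sub-cells have
constant apex level and hence no corner). This closes the outputs of both corner charts. -/
theorem rebaseSimplePos_xfreeBand (B m m' n₁ n₂ : ℕ) (s : KZ.IntegralRep (B + 1 + 1)) (M : Fin m' → (Fin (B + 1) → ℚ) × ℚ) (L : Fin m → (Fin B → ℚ) × ℚ) (e : Fin m → ℕ) (p : MvPolynomial (Fin B) ℚ) (ℓ₁ ℓ₂ : (Fin B → ℚ) × ℚ) (U V : (Fin (B + 1) → ℚ) × ℚ) (h12 : n₁ = 0 ∨ n₂ = 0) (hbd : Bornology.IsBounded s.domain) (hdom : s.domain = SeparatePos.gDom B 1 m' M (fun _ => Sum.inr U) (fun _ => Sum.inr V)) (hint : EqOn s.integrand (RebasePos.glit B 1 p L e ℓ₁ ℓ₂ n₁ n₂ (fun _ => some 0)) s.domain) (hU : ∀ i : Fin B, U.1 (Fin.castSucc i) = 0) (hV : ∀ i : Fin B, V.1 (Fin.castSucc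 i) = 0) (hcell : ∀ z : Fin (B + 1 + 1) → ℝ, (∀ j, 0 < SeparatePos.affF B 1 (M j) z) → 0 < SeparatePos.affF B 1 U z ∧ SeparatePos.affF B 1 U z < SeparatePos.affF B 1 V z) : ∃ c ∈ AddSubgroup.closure (SeparatePos.GGset B 2 1), KZ.of s - c ∈ KZ.relations :=
  RebasePos.good_xfree_band L e ℓ₁ ℓ₂ n₁ n₂ s M p U V h12 hbd hdom hint hU hV hcell

end Summit.KontsevichZagierPeriods.ArrangementNormalForm.JanusBands
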